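import Literature.NumberTheory.Automorphic.RankinSelbergTowerComparison
import HarnessLib

/-!
# The Iwasawa evaluation in torus coordinates for a general `N_n(𝔸_K)`-invariant integrand:
`∫_G F(x) |det x|^σ β(x) dν = C ∫_{(𝔸ˣ)ⁿ × K} F(diag(a) k) torusWeight σ a`
(Jacquet–Shalika (1981), §4; Cogdell (2004), §2.3)

Topic `NumberTheory/Automorphic`; namespace `Literature.NumberTheory.Automorphic`. Proof file
(theorems only). `RankinSelbergTowerComparison.lintegral_towerFun_zero_rsWeight_eq` transports the
Iwasawa evaluation `∫_G F β = C ∫_T ∫_K F(t k) δ(t)⁻¹` of `BorelTorusUnipotent` to the coordinates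
`a ∈ (𝔸_Kˣ)ⁿ` of the torus (`borelTorusEquiv`, `torusWeight σ a = |det diag(a)|^σ δ_B(a)⁻¹`) for the
specific integrand `‖Φ_0‖² Φ(e_n ·) |det|^σ` of the real-point Rankin–Selberg method. This file records
the same transport for an ARBITRARY measurable `F ≥ 0` left-invariant under `N_n(𝔸_K)`:

* `ideleNorm_det_eq_one_of_mem_adelicColRange` — `|det u|_𝔸 = 1` on `N_n(𝔸_K)`;
* `exists_lintegral_mul_rpow_mul_weight_eq_mul_lintegral_prod` (**main**) — there is `C ∈ (0, ∞)`
  (depending only on the Haar measures `ν`, `νA`, `νK`) with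
  `∫_G F(x) |det x|_𝔸^σ β(x) dν(x) = C ∫_{(𝔸ˣ)ⁿ × K} F(diag(a) k) torusWeight σ a d(νA ⊗ νK)`
  for every such `F`, every `σ ∈ ℝ` and every measurable `N_n(K)`-covering weight `β`;
* `lintegral_prod_torusPoint_le_mul_of_le` — if `F(diag(a) k) ≤ M(a)` for all `k ∈ K`, the right side is
  at most `νK(K) ∫ M(a) torusWeight σ a dνA(a)` — the reduction of the absolute convergence of unfolded
  Rankin–Selberg integrals to a torus integral of a majorant (Cogdell (2004), §2.3, "by the gauge
  estimates").

## References

* H. Jacquet, J. A. Shalika, Amer. J. Math. 103 (1981), §4 [JacquetShalikaAJM1981].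
* J. W. Cogdell, *Analytic theory of L-functions for GL_n* (2004), §2.3 [CogdellAnalyticTheory2004].
-/

noncomputable section

open MeasureTheory Measure NumberField IsDedekindDomain Matrix Set Filter Topology
open Literature.NumberTheory.GaloisRepresentations (ideleGroup)
open scoped MatrixGroups ENNReal NNReal

namespace Literature.NumberTheory.Automorphic

section Transport

variable {n : ℕ} {K : Type} [Field K] [NumberField K]
variable [MeasurableSpace (ideleGroup K)] [BorelSpace (ideleGroup K)]

attribute [local instance] adelicBorel borelSpace_adelic glAdeleBorel borelSpace_glAdele

omit [MeasurableSpace (ideleGroup K)] [BorelSpace (ideleGroup K)] in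
/-- `|det u|_𝔸 = 1` for `u ∈ N_n(𝔸_K) = U_{[1,n-1]}(𝔸_K)` (`det u = 1`). [folklore] -/
theorem ideleNorm_det_eq_one_of_mem_adelicColRange {u : GL (Fin n) (AdeleRing (𝓞 K) K)}
    (hu : u ∈ adelicColRange n K 1 (n - 1)) :
    IdeleClassGroup.ideleNorm K (Matrix.GeneralLinearGroup.det u) = 1 := by
  have hu' : u ∈ upperUnitriangular (Fin n) (AdeleRing (𝓞 K) K) := by
    have h := hu
    change u ∈ unipotentColRange n (AdeleRing (𝓞 K) K) 1 (n - 1) at h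
    rwa [unipotentColRange_one_eq_upperUnitriangular] at h
  rw [det_eq_one_of_mem_upperUnitriangular hu', map_one]

/-- **The Iwasawa evaluation in torus coordinates for an `N_n(𝔸_K)`-invariant integrand.** Let `0 < n`,
`ν` a Haar measure on `GL_n(𝔸_K)`, `νA` a Haar measure on `(𝔸_Kˣ)ⁿ` and `νK` a Haar measure on
`K = maximalCompactAdelic n K`. There is `C ∈ (0, ∞)`, depending only on the measures, such that for every
measurable `F ≥ 0` on `GL_n(𝔸_K)` left-invariant under `N_n(𝔸_K)`, every `σ ∈ ℝ` and every measurable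
`N_n(K)`-covering weight `β`,

  `∫ F(x) |det x|_𝔸^σ β(x) dν(x) = C ∫ F(diag(a) k) torusWeight σ a d(νA ⊗ νK)(a, k)`

(`exists_lintegral_mul_weight_eq_mul_lintegral_torus_maximalCompact` with the `N_n(𝔸_K)`-invariant
`F |det|^σ`, `|det (t k)| = |det t|`, `|det diag(a)|^σ δ_B(a)⁻¹ = torusWeight σ a`, Tonelli). [folklore] -/
theorem exists_lintegral_mul_rpow_mul_weight_eq_mul_lintegral_prod (hn : 0 < n)
    (ν : Measure (GL (Fin n) (AdeleRing (𝓞 K) K))) [IsHaarMeasure ν]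
    (νA : Measure (Fin n → ideleGroup K)) [IsHaarMeasure νA]
    (νK : Measure ↥(maximalCompactAdelic n K)) [IsHaarMeasure νK] :
    ∃ C : ℝ≥0∞, C ≠ 0 ∧ C ≠ ⊤ ∧
      ∀ {F : GL (Fin n) (AdeleRing (𝓞 K) K) → ℝ≥0∞}, Measurable F →
        (∀ u : GL (Fin n) (AdeleRing (𝓞 K) K), u ∈ adelicColRange n K 1 (n - 1) → ∀ x, F (u * x) = F x) →
      ∀ (σ : ℝ) {β : GL (Fin n) (AdeleRing (𝓞 K) K) → ℝ≥0∞}, Measurable β →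
        (∀ x, Literature.MeasureTheory.Group.coveringSum ↥(ratPoints (tailUnipotent n K 0)) β x = 1) →
        ∫⁻ x, F x * ENNReal.ofReal ((IdeleClassGroup.ideleNorm K (Matrix.GeneralLinearGroup.det x) : ℝ) ^ σ) * β x ∂ν =
          C * ∫⁻ p, F (torusPoint n K p) * ENNReal.ofReal (torusWeight n K σ p.1) ∂(νA.prod νK) := by
  haveI := secondCountableTopology_ideleGroup K
  haveI := locallyCompactSpace_ideleGroup K
  haveI : SecondCountableTopology (GL (Fin n) (AdeleRing (𝓞 K) K)) := secondCountableTopology_generalLinearGroup_adeleRing K (Fin n)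
  haveI : SecondCountableTopology (AdelicGroupData.gl n K).Adelic := secondCountableTopology_generalLinearGroup_adeleRing K (Fin n)
  haveI : SecondCountableTopology ↥(maximalCompactAdelic n K) := TopologicalSpace.Subtype.secondCountableTopology _
  haveI : SecondCountableTopology ↥(standardParabolicGL (AdeleRing (𝓞 K) K) (id : Fin n → Fin n)) :=
    TopologicalSpace.Subtype.secondCountableTopology _
  haveI : SecondCountableTopology ↥(leviP (AdeleRing (𝓞 K) K) (id : Fin n → Fin n)) := TopologicalSpace.Subtype.secondCountableTopology _
  haveI : CompactSpace ↥(maximalCompactAdelic n K) := isCompact_iff_compactSpace.1 (isCompact_maximalCompactAdelic n K)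
  haveI := locallyCompactSpace_adeleRing' K
  -- the torus measure transported to `T ≤ B`
  set eT := (borelTorusEquiv (n := n) (K := K)) with heT
  set μT : Measure ↥(leviP (AdeleRing (𝓞 K) K) (id : Fin n → Fin n)) := νA.map eT with hμT
  haveI : IsHaarMeasure μT := eT.isHaarMeasure_map νA
  obtain ⟨C, hC0, hCtop, hmain⟩ :=
    @exists_lintegral_mul_weight_eq_mul_lintegral_torus_maximalCompact n K _ _ _ _ hn ν _ μT _ νK
      (inferInstance : IsHaarMeasure νK)
  refine ⟨C, hC0, hCtop, fun {F} hF hFN σ {β} hβm hβ => ?_⟩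
  -- the invariant integrand `F |det|^σ`
  set F' : GL (Fin n) (AdeleRing (𝓞 K) K) → ℝ≥0∞ := fun x =>
    F x * ENNReal.ofReal ((IdeleClassGroup.ideleNorm K (Matrix.GeneralLinearGroup.det x) : ℝ) ^ σ) with hF'
  have hdetm : Measurable fun x : GL (Fin n) (AdeleRing (𝓞 K) K) =>
      ENNReal.ofReal ((IdeleClassGroup.ideleNorm K (Matrix.GeneralLinearGroup.det x) : ℝ) ^ σ) :=
    ENNReal.measurable_ofReal.comp ((measurable_subtype_coe.comp ((continuous_ideleNorm_holds K).measurable.comp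
      Matrix.GeneralLinearGroup.continuous_det.measurable)).pow_const _)
  have hF'm : Measurable F' := hF.mul hdetm
  have hF'N : ∀ u : GL (Fin n) (AdeleRing (𝓞 K) K), u ∈ adelicColRange n K 1 (n - 1) → ∀ x, F' (u * x) = F' x := by
    intro u hu x
    simp only [hF']
    rw [hFN u hu x, map_mul, map_mul, ideleNorm_det_eq_one_of_mem_adelicColRange hu, one_mul]
  have hlhs : ∫⁻ x, F x * ENNReal.ofReal ((IdeleClassGroup.ideleNorm K (Matrix.GeneralLinearGroup.det x) : ℝ) ^ σ) * β x ∂ν =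
      ∫⁻ x, F' x * β x ∂ν := rfl
  rw [hlhs, hmain hF'm hF'N hβm hβ]
  congr 1
  -- the inner integral in the spelling `maximalCompactAdelic`
  change ∫⁻ t, ∫⁻ k : ↥(maximalCompactAdelic n K),
      F' (((t : ↥(standardParabolicGL (AdeleRing (𝓞 K) K) (id : Fin n → Fin n))) :
        GL (Fin n) (AdeleRing (𝓞 K) K)) * (show GL (Fin n) (AdeleRing (𝓞 K) K) from (k : (AdelicGroupData.gl n K).Adelic))) *
        ((colRangeDiagModulus (n := n) (K := K) 1 (n - 1)
          (borelDiagUnit (t : ↥(standardParabolicGL (AdeleRing (𝓞 K) K) (id : Fin n → Fin n)))) : ℝ≥0∞))⁻¹ ∂νK ∂μT = _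
  have hmeq : ∀ G : ↥(leviP (AdeleRing (𝓞 K) K) (id : Fin n → Fin n)) → ℝ≥0∞, Measurable G → ∫⁻ t, G t ∂μT = ∫⁻ a, G (eT a) ∂νA := by
    intro G hG
    rw [hμT, lintegral_map hG (show Measurable fun a => eT a from eT.continuous.measurable)]
  -- the integrand in torus coordinates
  set I : (Fin n → ideleGroup K) × ↥(maximalCompactAdelic n K) → ℝ≥0∞ := fun p =>
    F (torusPoint n K p) * ENNReal.ofReal (torusWeight n K σ p.1) with hI
  have hpt : ∀ (a : Fin n → ideleGroup K) (k : ↥(maximalCompactAdelic n K)),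
      F' ((((eT a : ↥(leviP (AdeleRing (𝓞 K) K) (id : Fin n → Fin n))) : ↥(standardParabolicGL (AdeleRing (𝓞 K) K) (id : Fin n → Fin n))) :
        GL (Fin n) (AdeleRing (𝓞 K) K)) * (show GL (Fin n) (AdeleRing (𝓞 K) K) from (k : (AdelicGroupData.gl n K).Adelic))) *
        ((colRangeDiagModulus (n := n) (K := K) 1 (n - 1) (borelDiagUnit ((eT a : ↥(leviP (AdeleRing (𝓞 K) K) (id : Fin n → Fin n))) : ↥(standardParabolicGL (AdeleRing (𝓞 K) K) (id : Fin n → Fin n)))) : ℝ≥0∞))⁻¹ =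
      I (a, k) := by
    intro a k
    have hcoe : ((((eT a : ↥(leviP (AdeleRing (𝓞 K) K) (id : Fin n → Fin n))) : ↥(standardParabolicGL (AdeleRing (𝓞 K) K) (id : Fin n → Fin n))) : GL (Fin n) (AdeleRing (𝓞 K) K))) =
        glDiagonal n (AdeleRing (𝓞 K) K) a := rfl
    have hunit : borelDiagUnit ((eT a : ↥(leviP (AdeleRing (𝓞 K) K) (id : Fin n → Fin n))) : ↥(standardParabolicGL (AdeleRing (𝓞 K) K) (id : Fin n → Fin n))) = a :=
      borelDiagUnit_borelTorusEquiv a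
    rw [hcoe, hunit]
    simp only [hF', hI]
    rw [ideleNorm_det_mul_maximalCompactAdelic, mul_assoc, ← ofReal_torusWeight_eq_one hn σ a]
    rfl
  have hIm : Measurable I :=
    (hF.comp continuous_torusPoint.measurable).mul
      (ENNReal.measurable_ofReal.comp ((continuous_torusWeight σ).measurable.comp measurable_fst))
  have hG : Measurable fun t : ↥(leviP (AdeleRing (𝓞 K) K) (id : Fin n → Fin n)) => ∫⁻ k : ↥(maximalCompactAdelic n K),
      F' (((t : ↥(standardParabolicGL (AdeleRing (𝓞 K) K) (id : Fin n → Fin n))) : GL (Fin n) (AdeleRing (𝓞 K) K)) * (show GL (Fin n) (AdeleRing (𝓞 K) K) from (k : (AdelicGroupData.gl n K).Adelic))) *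
        ((colRangeDiagModulus (n := n) (K := K) 1 (n - 1) (borelDiagUnit (t : ↥(standardParabolicGL (AdeleRing (𝓞 K) K) (id : Fin n → Fin n)))) : ℝ≥0∞))⁻¹ ∂νK := by
    have h1 : (fun t : ↥(leviP (AdeleRing (𝓞 K) K) (id : Fin n → Fin n)) => ∫⁻ k : ↥(maximalCompactAdelic n K),
        F' (((t : ↥(standardParabolicGL (AdeleRing (𝓞 K) K) (id : Fin n → Fin n))) : GL (Fin n) (AdeleRing (𝓞 K) K)) * (show GL (Fin n) (AdeleRing (𝓞 K) K) from (k : (AdelicGroupData.gl n K).Adelic))) *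
          ((colRangeDiagModulus (n := n) (K := K) 1 (n - 1) (borelDiagUnit (t : ↥(standardParabolicGL (AdeleRing (𝓞 K) K) (id : Fin n → Fin n)))) : ℝ≥0∞))⁻¹ ∂νK) =
        (fun a : Fin n → ideleGroup K => ∫⁻ k : ↥(maximalCompactAdelic n K), I (a, k) ∂νK) ∘ eT.symm := by
      funext t
      simp only [Function.comp_apply]
      conv_lhs => rw [← eT.apply_symm_apply t]
      exact lintegral_congr fun k => hpt _ k
    rw [h1]
    exact (hIm.lintegral_prod_right').comp eT.symm.continuous.measurable
  rw [hmeq _ hG]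
  simp_rw [hpt]
  rw [lintegral_prod _ hIm.aemeasurable]

/-- **Bounding the torus-coordinate integral by a majorant in `a` alone**: if
`F(diag(a) k) ≤ M(a)` for all `k ∈ K`, then
`∫ F(diag(a) k) torusWeight σ a d(νA ⊗ νK) ≤ νK(K) ∫ M(a) torusWeight σ a dνA(a)`. [folklore] -/
theorem lintegral_prod_torusPoint_le_mul_of_le
    (νA : Measure (Fin n → ideleGroup K)) [SFinite νA]
    (νK : Measure ↥(maximalCompactAdelic n K)) [SFinite νK]
    {F : GL (Fin n) (AdeleRing (𝓞 K) K) → ℝ≥0∞} {M : (Fin n → ideleGroup K) → ℝ≥0∞} (hM : Measurable M)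
    (hle : ∀ (a : Fin n → ideleGroup K) (k : ↥(maximalCompactAdelic n K)), F (torusPoint n K (a, k)) ≤ M a) (σ : ℝ) :
    ∫⁻ p, F (torusPoint n K p) * ENNReal.ofReal (torusWeight n K σ p.1) ∂(νA.prod νK) ≤
      νK Set.univ * ∫⁻ a, M a * ENNReal.ofReal (torusWeight n K σ a) ∂νA := by
  haveI := secondCountableTopology_ideleGroup K
  have hGm : Measurable fun a : Fin n → ideleGroup K => M a * ENNReal.ofReal (torusWeight n K σ a) :=
    hM.mul (ENNReal.measurable_ofReal.comp (continuous_torusWeight σ).measurable)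
  calc ∫⁻ p, F (torusPoint n K p) * ENNReal.ofReal (torusWeight n K σ p.1) ∂(νA.prod νK)
      ≤ ∫⁻ p : (Fin n → ideleGroup K) × ↥(maximalCompactAdelic n K), M p.1 * ENNReal.ofReal (torusWeight n K σ p.1) ∂(νA.prod νK) :=
        lintegral_mono fun p => mul_le_mul_left (hle p.1 p.2) _
    _ = ∫⁻ a, ∫⁻ _k : ↥(maximalCompactAdelic n K), M a * ENNReal.ofReal (torusWeight n K σ a) ∂νK ∂νA :=
        lintegral_prod _ (hGm.comp measurable_fst).aemeasurable
    _ = ∫⁻ a, M a * ENNReal.ofReal (torusWeight n K σ a) * νK Set.univ ∂νA := by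
        refine lintegral_congr fun a => ?_
        rw [lintegral_const]
    _ = νK Set.univ * ∫⁻ a, M a * ENNReal.ofReal (torusWeight n K σ a) ∂νA := by
        rw [lintegral_mul_const _ hGm, mul_comm]

end Transport

end Literature.NumberTheory.Automorphic
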